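import Literature.Analysis.FluidPDE.CaloricRemainderRawCoupling
import Literature.Analysis.FluidPDE.LocalLerayInitialSliceLEI
import Literature.Analysis.FluidPDE.KatoCaloricField
import Literature.Analysis.FluidPDE.PlateauWindowKernels
import HarnessLib

/-!
# Jia–Šverák's Lemma 8, step 1: the energy inequality of `w = v - e^{tΔ}v₀` for a slab local
# Leray solution, tested with a time plateau times a spatial cut-off

Analysis/FluidPDE proof file (theorems only, no definitions, no named facts) for the discharge of
the named fact `Literature.Analysis.FluidPDE.jia_sverak_2013_lemma_8` (H. Jia, V. Šverák, SIAM J.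
Math. Anal. 45 (2013) = arXiv:1201.1592, **Lemma 8**, p. 7, "the main new observation that enables
us to work in `L³`": for a local Leray solution `u` with datum `u₀ ∈ L³`, `‖u₀‖₃ ≤ M`,
`‖u(·,t) - e^{Δt}u₀‖_{L²(B₁(x₀))} ≤ h_M(t) → 0`, uniformly in `x₀`; printed proof: "By estimates of
`u` from Corollary 1 and estimates on `v`, local energy estimates for `w` and parabolic regularity,
one can conclude (we omit the routine calculations)").

The discharge does **not** follow the printed splitting `u₀ = a + b` (which needs the Leray
projector on `Lᵖ` and the `L⁶` mild theory); it compares `u` directly with the free evolution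
`e = e^{tΔ}u₀` of the same datum, in the manner of Seregin–Šverák 2017, (1.7): the local energy
inequality of the remainder `w = u - e` (`caloric_remainder_energy_inequality_raw`,
`CaloricRemainderRawCoupling.lean`), the critical coupling `⟪De(w), w⟫` integrated by parts onto
`w` and controlled by Giga's `L⁵` bound of the free flow (`JiaSverak2013Lemma8SliceTools.lean`,
`HeatFlowGigaL5.lean`), the remaining terms by Jia–Šverák's Cor. 1
(`jia_sverak_2013_corollary_1_holds`), and Grönwall.

This file performs the first, purely book-keeping step: for a local Leray solution `(v, π)` on
the slab `(0, T) × ℝ³` (`IsLocalLeraySolutionOn T 1 v₀ v π`) with `v₀ ∈ L³` weakly divergence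
free, a weak spatial gradient `G` carrying the local energy inequality, a smooth compactly
supported spatial weight `θ ≥ 0`, and the smooth time plateau `σ = timePlateau δ τ`
(`= 1` on `[2δ, τ - 2δ]`, `= 0` off `(δ, τ - δ)`), the inequality
`caloric_remainder_energy_inequality_raw` on the slab `(δ/2, T)`, with the caloric field replaced by
its smooth time cut-off (which agrees with `e` where `σ ≠ 0`) and the test function
`φ(t, x) = σ(t) θ(x)`, is rewritten with the weights pulled out of the space integrals
(`windowed_remainder_inequality`):

  `2 ∫ σ(t) D(t) dt ≤ ∫ σ'(t) Y(t) dt + ∫ σ(t) (R₁ + R₂ + 2R₃ - 2R₄ - 2R₅ + R₆ + R₇)(t) dt`,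

`Y(t) = ∫ θ |w(t)|²`, `D(t) = ∫ θ |G(t) - De(t)|²`, `R₁ = ∫ |w|² Δθ`, `R₂ = ∫ (|w|² - |e|²) v·∇θ`,
`R₃ = ∫ π w·∇θ`, `R₄ = ∫ θ⟪De(w), w⟫`, `R₅ = ∫ θ⟪De(e), w⟫`, `R₆ = ∫ |e|² w·∇θ`,
`R₇ = ∫ (e·∇θ)|e|²` (all at time `t`). It also records the classes of `v`, `π` on compact
subsets of the open slab in the form consumed by `caloric_remainder_energy_inequality_raw`.

## Mathlib / tree search

Tree: `caloric_remainder_energy_inequality_raw` (`CaloricRemainderRawCoupling.lean`);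
`contDiff_uncurry_cutoffHeatFlow`, `cutoffHeatFlow_eq_of_le`, `hasDerivAt_cutoffHeatFlow_time`,
`isDivFree_cutoffHeatFlow` (`KatoCaloricField.lean`); `timePlateau`, `contDiff_timePlateau`,
`tsupport_timePlateau_subset` (`KatoLocalLerayPressure.lean`); `isSpaceTimeTestOn_mul_of_support_subset`,
`timeDeriv_mul_const_space`, `gradient_mul_const_time`, `laplacian_mul_const_time`
(`PlateauWindowKernels.lean`); `IsLocalLeraySolutionOn.integrableOn_cube_cylinder`,
`IsLocalLeraySolutionOn.integrableOn_abs_pressure_rpow_cylinder` (`LocalLerayInitialSliceLEI.lean`).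

## References

* H. Jia, V. Šverák, SIAM J. Math. Anal. 45 (2013) 1448–1459 = arXiv:1201.1592, Lemma 8 (p. 7).
  [JiaSverak2013]
* G. Seregin, V. Šverák, Nonlinear Anal. 154 (2017) 269–296 = arXiv:1601.03096, §1 (1.7).
  [SereginSverak2017]
* P. G. Lemarié-Rieusset, *The Navier–Stokes problem in the 21st century* (2016), Prop. 15.1;
  Thm. 14.7, proof pp. 515–518; Thm. 14.2, proof p. 499 (the test function `γ(s)φ(x)`).
  [LemarieRieusset2016]
-/

noncomputable section

open MeasureTheory TopologicalSpace Set Function Filter Metric InnerProductSpace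
open _root_.Topology
open scoped ENNReal NNReal RealInnerProductSpace Laplacian

namespace Literature.Analysis.FluidPDE

namespace IsLocalLeraySolutionOn

variable {T ν : ℝ} {v₀ : EuclideanSpace ℝ (Fin 3) → EuclideanSpace ℝ (Fin 3)}
  {v : ℝ → EuclideanSpace ℝ (Fin 3) → EuclideanSpace ℝ (Fin 3)}
  {π : ℝ → EuclideanSpace ℝ (Fin 3) → ℝ}

/-! ## The classes of `v` and `π` on compact subsets of the open slab -/

/-- A compact subset of the open slab `(0,T) × ℝ³` lies in the finite cylinder `(0,T) × K'` over
its (compact) spatial shadow `K'`. [folklore] -/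
theorem subset_cylinder_shadow {K : Set (ℝ × EuclideanSpace ℝ (Fin 3))}
    (hK : K ⊆ ((slab (EuclideanSpace ℝ (Fin 3)) (Ioo 0 T) isOpen_Ioo :
      Opens (ℝ × EuclideanSpace ℝ (Fin 3))) : Set (ℝ × EuclideanSpace ℝ (Fin 3)))) :
    K ⊆ Ioo 0 T ×ˢ (Prod.snd '' K) := fun z hz =>
  ⟨mem_slab.1 (hK hz), ⟨z, hz, rfl⟩⟩

/-- **`v ∈ L³(K)` for every compact `K` in the open slab** (the class hypothesis `hu3` of the
caloric-remainder inequalities), from the integrability of `|v|³` on finite cylinders. [folklore] -/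
theorem memLp_three_of_isCompact (h : IsLocalLeraySolutionOn T ν v₀ v π)
    {K : Set (ℝ × EuclideanSpace ℝ (Fin 3))}
    (hK : K ⊆ ((slab (EuclideanSpace ℝ (Fin 3)) (Ioo 0 T) isOpen_Ioo :
      Opens (ℝ × EuclideanSpace ℝ (Fin 3))) : Set (ℝ × EuclideanSpace ℝ (Fin 3))))
    (hKc : IsCompact K) : MemLp (uncurry v) 3 (volume.restrict K) := by
  have hK' : IsCompact (Prod.snd '' K) := hKc.image continuous_snd
  have hsub := subset_cylinder_shadow hK
  have hcube := (h.integrableOn_cube_cylinder hK').mono_set hsub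
  have hmeas : AEStronglyMeasurable (uncurry v) (volume.restrict K) :=
    h.aestronglyMeasurable.mono_measure
      (Measure.restrict_mono (hsub.trans (Set.prod_mono Subset.rfl (subset_univ _))) le_rfl)
  refine ⟨hmeas, ?_⟩
  rw [eLpNorm_lt_top_iff_lintegral_rpow_enorm_lt_top (by norm_num) (by norm_num)]
  simp only [ENNReal.toReal_ofNat, ENNReal.rpow_ofNat]
  have hfi := hcube.hasFiniteIntegral
  rw [hasFiniteIntegral_iff_enorm] at hfi
  refine lt_of_le_of_lt (lintegral_mono fun z => le_of_eq ?_) hfi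
  rw [Real.enorm_eq_ofReal (pow_nonneg (norm_nonneg _) 3), ← ofReal_norm, ENNReal.ofReal_pow (norm_nonneg _)]
  rfl

/-- **`π ∈ L^{3/2}(K)` for every compact `K` in the open slab** (the class hypothesis `hp32`).
[folklore] -/
theorem memLp_pressure_of_isCompact (h : IsLocalLeraySolutionOn T ν v₀ v π)
    {K : Set (ℝ × EuclideanSpace ℝ (Fin 3))}
    (hK : K ⊆ ((slab (EuclideanSpace ℝ (Fin 3)) (Ioo 0 T) isOpen_Ioo :
      Opens (ℝ × EuclideanSpace ℝ (Fin 3))) : Set (ℝ × EuclideanSpace ℝ (Fin 3))))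
    (hKc : IsCompact K) : MemLp (uncurry π) (3 / 2) (volume.restrict K) := by
  have hK' : IsCompact (Prod.snd '' K) := hKc.image continuous_snd
  have hsub := subset_cylinder_shadow hK
  have hp32 := (h.integrableOn_abs_pressure_rpow_cylinder hK').mono_set hsub
  have hmeas : AEStronglyMeasurable (uncurry π) (volume.restrict K) :=
    (h.integrableOn_pressure hK').aestronglyMeasurable.mono_measure (Measure.restrict_mono hsub le_rfl)
  refine ⟨hmeas, ?_⟩
  rw [eLpNorm_lt_top_iff_lintegral_rpow_enorm_lt_top (by norm_num)
    (ENNReal.div_ne_top (by norm_num) (by norm_num))]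
  have e32 : ((3 : ℝ≥0∞) / 2).toReal = 3 / 2 := by rw [ENNReal.toReal_div]; norm_num
  rw [e32]
  have hfi := hp32.hasFiniteIntegral
  rw [hasFiniteIntegral_iff_enorm] at hfi
  refine lt_of_le_of_lt (lintegral_mono fun z => le_of_eq ?_) hfi
  rw [Real.enorm_eq_ofReal (Real.rpow_nonneg (abs_nonneg _) _), Real.enorm_eq_ofReal_abs,
    ENNReal.ofReal_rpow_of_nonneg (abs_nonneg _) (by norm_num)]
  rfl

/-! ## The windowed inequality -/

set_option maxHeartbeats 3200000 in
/-- **The energy inequality of `w = v - e^{tΔ}v₀`, tested with `σ(t) θ(x)`** (Jia–Šverák 2013,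
proof of Lemma 8, the "local energy estimates for `w`"; Lemarié-Rieusset 2016, proof of Thm. 14.2
p. 499, the test function `γ(s)φ(x)`, and proof of Thm. 14.7 pp. 515–518). In the setting of the
module docstring, with `σ = timePlateau δ τ`, `0 < δ`, `τ < T`, `e(t) = e^{tΔ}v₀`, `w = v - e`:
`2∫ σ D ≤ ∫ σ' Y + ∫ σ R₁ + ∫ σ R₂ + 2∫ σ R₃ - 2∫ σ R₄ - 2∫ σ R₅ + ∫ σ R₆ + ∫ σ R₇`
(the slice functionals `Y, D, R₁, …, R₇` written out in the statement).
[cite: JiaSverak2013, Lemma 8, proof (arXiv:1201.1592 p. 7)] [cite: LemarieRieusset2016, Thm. 14.2 proof (p. 499) and Thm. 14.7 proof (pp. 515–518)] -/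
theorem windowed_remainder_inequality (h : IsLocalLeraySolutionOn T 1 v₀ v π)
    (hv₀ : MemLp v₀ 3 volume) (hdiv₀ : IsWeaklyDivFree v₀)
    {G : ℝ → EuclideanSpace ℝ (Fin 3) → EuclideanSpace ℝ (Fin 3) →L[ℝ] EuclideanSpace ℝ (Fin 3)}
    (hG : HasWeakSpatialGradientOn (slab (EuclideanSpace ℝ (Fin 3)) (Ioo 0 T) isOpen_Ioo) v G)
    (hG2 : ∀ K ⊆ ((slab (EuclideanSpace ℝ (Fin 3)) (Ioo 0 T) isOpen_Ioo :
      Opens (ℝ × EuclideanSpace ℝ (Fin 3))) : Set (ℝ × EuclideanSpace ℝ (Fin 3))), IsCompact K →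
      ∫⁻ z in K, ENNReal.ofReal (frobeniusNormSq (G z.1 z.2)) < ∞)
    (hLEI : ∀ φ : ℝ → EuclideanSpace ℝ (Fin 3) → ℝ,
      IsSpaceTimeTestOn (slab (EuclideanSpace ℝ (Fin 3)) (Ioo 0 T) isOpen_Ioo) φ → (∀ t x, 0 ≤ φ t x) →
      2 * (1 : ℝ) * ∫ t, ∫ x, frobeniusNormSq (G t x) * φ t x ≤
        ∫ t, ∫ x, (‖v t x‖ ^ 2 * (timeDeriv φ t x + 1 * Δ (φ t) x) +
          (‖v t x‖ ^ 2 + 2 * π t x) * ⟪v t x, gradient (φ t) x⟫ +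
          2 * ⟪(0 : ℝ → EuclideanSpace ℝ (Fin 3) → EuclideanSpace ℝ (Fin 3)) t x, v t x⟫ * φ t x))
    {θ : EuclideanSpace ℝ (Fin 3) → ℝ} (hθ : ContDiff ℝ (⊤ : ℕ∞) θ) (hθc : HasCompactSupport θ)
    (hθ0 : ∀ x, 0 ≤ θ x) {δ τ : ℝ} (hδ : 0 < δ) (hτT : τ < T) :
    2 * ∫ t, ∫ x, timePlateau δ τ t *
        (θ x * frobeniusNormSq (G t x - fderiv ℝ (heatFlow v₀ (1 * t)) x)) ≤
      (∫ t, ∫ x, (deriv (timePlateau δ τ) t * (θ x * ‖v t x - heatFlow v₀ (1 * t) x‖ ^ 2) +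
        timePlateau δ τ t * (‖v t x - heatFlow v₀ (1 * t) x‖ ^ 2 * (Δ θ) x))) +
      (∫ t, ∫ x, timePlateau δ τ t *
        ((‖v t x - heatFlow v₀ (1 * t) x‖ ^ 2 - ‖heatFlow v₀ (1 * t) x‖ ^ 2) * ⟪v t x, gradient θ x⟫)) +
      2 * (∫ t, ∫ x, timePlateau δ τ t * (π t x * ⟪v t x - heatFlow v₀ (1 * t) x, gradient θ x⟫)) -
      2 * (∫ t, ∫ x, timePlateau δ τ t * (θ x *
        ⟪fderiv ℝ (heatFlow v₀ (1 * t)) x (v t x - heatFlow v₀ (1 * t) x), v t x - heatFlow v₀ (1 * t) x⟫)) -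
      2 * (∫ t, ∫ x, timePlateau δ τ t * (θ x *
        ⟪fderiv ℝ (heatFlow v₀ (1 * t)) x (heatFlow v₀ (1 * t) x), v t x - heatFlow v₀ (1 * t) x⟫)) +
      (∫ t, ∫ x, timePlateau δ τ t *
        (‖heatFlow v₀ (1 * t) x‖ ^ 2 * ⟪v t x - heatFlow v₀ (1 * t) x, gradient θ x⟫)) +
      ∫ t, ∫ x, timePlateau δ τ t *
        (⟪heatFlow v₀ (1 * t) x, gradient θ x⟫ * ‖heatFlow v₀ (1 * t) x‖ ^ 2) := by
  have hν : (0 : ℝ) < 1 := one_pos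
  -- ### the window, the test function, the cut-off caloric field
  set σ : ℝ → ℝ := timePlateau δ τ with hσdef
  have hσs : ContDiff ℝ (⊤ : ℕ∞) σ := contDiff_timePlateau δ τ
  have hσd : Differentiable ℝ σ := hσs.differentiable (by simp)
  have hσsupp : support σ ⊆ Icc δ (τ - δ) :=
    (subset_tsupport _).trans (tsupport_timePlateau_subset hδ)
  have hσz : ∀ t, t ∉ Ioo δ (τ - δ) → σ t = 0 := fun t ht => timePlateau_eq_zero_of_notMem hδ ht
  have hσ'z : ∀ t, t ∉ Ioo δ (τ - δ) → deriv σ t = 0 := fun t ht =>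
    deriv_timePlateau_eq_zero_of_notMem hδ ht
  set φ : ℝ → EuclideanSpace ℝ (Fin 3) → ℝ := fun t x => σ t * θ x with hφdef
  set Ω' : Opens (ℝ × EuclideanSpace ℝ (Fin 3)) :=
    slab (EuclideanSpace ℝ (Fin 3)) (Ioo (δ / 2) T) isOpen_Ioo with hΩ'def
  have hΩ' : Ω' ≤ slab (EuclideanSpace ℝ (Fin 3)) (Ioo 0 T) isOpen_Ioo :=
    slab_mono (Ioo_subset_Ioo (by positivity) le_rfl)
  have hφ : IsSpaceTimeTestOn Ω' φ :=
    isSpaceTimeTestOn_mul_of_support_subset hσs hσsupp (by linarith) (by linarith) hθ hθc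
  have hφ0 : ∀ t x, 0 ≤ φ t x := fun t x => mul_nonneg (timePlateau_nonneg δ τ t) (hθ0 x)
  set Ec : ℝ → EuclideanSpace ℝ (Fin 3) → EuclideanSpace ℝ (Fin 3) :=
    fun t x => Real.smoothTransition (4 * t / δ - 1) • heatFlow v₀ (1 * t) x with hEc
  have hEcs : ContDiff ℝ (⊤ : ℕ∞) (uncurry Ec) := contDiff_uncurry_cutoffHeatFlow hv₀ (by norm_num) hν hδ
  have hEcheat : ∀ z ∈ (Ω' : Set (ℝ × EuclideanSpace ℝ (Fin 3))),
      HasDerivAt (fun s => Ec s z.2) ((1 : ℝ) • (Δ (Ec z.1)) z.2) z.1 := by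
    intro z hz
    have hz1 : δ / 2 < z.1 := (mem_slab.1 hz).1
    exact hasDerivAt_cutoffHeatFlow_time hv₀ (by norm_num) hν hδ hz1 z.2
  have hEcdiv : ∀ t, VectorCalculus.IsDivFree (Ec t) := fun t =>
    isDivFree_cutoffHeatFlow hdiv₀ hv₀ (by norm_num) hν hδ t
  have hEc_eq : ∀ t, δ ≤ t → Ec t = heatFlow v₀ (1 * t) := fun t ht =>
    funext fun x => cutoffHeatFlow_eq_of_le hδ (by linarith) x
  -- ### the hypotheses of the raw inequality on `Ω'`
  have hG2' : ∀ K ⊆ (Ω' : Set (ℝ × EuclideanSpace ℝ (Fin 3))), IsCompact K →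
      ∫⁻ z in K, ENNReal.ofReal (frobeniusNormSq (G z.1 z.2)) < ∞ := fun K hK hKc => hG2 K (hK.trans hΩ') hKc
  have hLEI' : ∀ ψ : ℝ → EuclideanSpace ℝ (Fin 3) → ℝ, IsSpaceTimeTestOn Ω' ψ → (∀ t x, 0 ≤ ψ t x) →
      2 * (1 : ℝ) * ∫ t, ∫ x, frobeniusNormSq (G t x) * ψ t x ≤
        ∫ t, ∫ x, (‖v t x‖ ^ 2 * (timeDeriv ψ t x + 1 * Δ (ψ t) x) +
          (‖v t x‖ ^ 2 + 2 * π t x) * ⟪v t x, gradient (ψ t) x⟫ +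
          2 * ⟪(0 : ℝ → EuclideanSpace ℝ (Fin 3) → EuclideanSpace ℝ (Fin 3)) t x, v t x⟫ * ψ t x) :=
    fun ψ hψ hψ0 => hLEI ψ (hψ.mono hΩ') hψ0
  have hu3' : ∀ K ⊆ (Ω' : Set (ℝ × EuclideanSpace ℝ (Fin 3))), IsCompact K →
      MemLp (uncurry v) 3 (volume.restrict K) := fun K hK hKc => h.memLp_three_of_isCompact (hK.trans hΩ') hKc
  have hp32' : ∀ K ⊆ (Ω' : Set (ℝ × EuclideanSpace ℝ (Fin 3))), IsCompact K →
      MemLp (uncurry π) (3 / 2) (volume.restrict K) := fun K hK hKc => h.memLp_pressure_of_isCompact (hK.trans hΩ') hKc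
  have h5 := caloric_remainder_energy_inequality_raw (h.distributional.of_le hΩ') (hG.mono hΩ') hG2' hLEI'
    hu3' hp32' hEcs hEcheat hEcdiv hφ hφ0
  -- ### the weights
  have hφt : ∀ t x, timeDeriv φ t x = deriv σ t * θ x := fun t x => timeDeriv_mul_const_space θ hσd t x
  have hφg : ∀ t x, gradient (φ t) x = σ t • gradient θ x := fun t x =>
    gradient_mul_const_time σ t ((hθ.differentiable (by simp)) x)
  have hφL : ∀ t x, (Δ (φ t)) x = σ t * (Δ θ) x := fun t x =>
    laplacian_mul_const_time σ (contDiff_infty.1 hθ 2) t x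
  -- ### identification of the integrands: where `σ` or `σ'` is nonzero, `Ec = e`
  -- a pointwise rewriting principle: both sides vanish off `(δ, τ - δ)`, and `Ec t = e t` on it
  have pw : ∀ (t : ℝ) (x : EuclideanSpace ℝ (Fin 3))
      (F : (EuclideanSpace ℝ (Fin 3) → EuclideanSpace ℝ (Fin 3)) → ℝ),
      σ t * F (Ec t) = σ t * F (heatFlow v₀ (1 * t)) := by
    intro t x F
    by_cases ht : t ∈ Ioo δ (τ - δ)
    · rw [hEc_eq t ht.1.le]
    · rw [hσz t ht, zero_mul, zero_mul]
  have pw' : ∀ (t : ℝ) (x : EuclideanSpace ℝ (Fin 3))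
      (F : (EuclideanSpace ℝ (Fin 3) → EuclideanSpace ℝ (Fin 3)) → ℝ),
      deriv σ t * F (Ec t) = deriv σ t * F (heatFlow v₀ (1 * t)) := by
    intro t x F
    by_cases ht : t ∈ Ioo δ (τ - δ)
    · rw [hEc_eq t ht.1.le]
    · rw [hσ'z t ht, zero_mul, zero_mul]
  -- LHS
  have eL : (∫ t, ∫ x, frobeniusNormSq (G t x - fderiv ℝ (Ec t) x) * φ t x) =
      ∫ t, ∫ x, σ t * (θ x * frobeniusNormSq (G t x - fderiv ℝ (heatFlow v₀ (1 * t)) x)) := by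
    refine integral_congr_ae (ae_of_all _ fun t => integral_congr_ae (ae_of_all _ fun x => ?_))
    have := pw t x (fun E => θ x * frobeniusNormSq (G t x - fderiv ℝ E x))
    simp only [hφdef] at this ⊢
    rw [← this]; ring
  have e1 : (∫ t, ∫ x, ‖v t x - Ec t x‖ ^ 2 * (timeDeriv φ t x + 1 * Δ (φ t) x)) =
      ∫ t, ∫ x, (deriv σ t * (θ x * ‖v t x - heatFlow v₀ (1 * t) x‖ ^ 2) +
        σ t * (‖v t x - heatFlow v₀ (1 * t) x‖ ^ 2 * (Δ θ) x)) := by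
    refine integral_congr_ae (ae_of_all _ fun t => integral_congr_ae (ae_of_all _ fun x => ?_))
    have h1 := pw' t x (fun E => θ x * ‖v t x - E x‖ ^ 2)
    have h2 := pw t x (fun E => ‖v t x - E x‖ ^ 2 * (Δ θ) x)
    simp only [hφt, hφL] at h1 h2 ⊢
    rw [← h1, ← h2]; ring
  have e2 : (∫ t, ∫ x, (‖v t x - Ec t x‖ ^ 2 - ‖Ec t x‖ ^ 2) * ⟪v t x, gradient (φ t) x⟫) =
      ∫ t, ∫ x, σ t * ((‖v t x - heatFlow v₀ (1 * t) x‖ ^ 2 - ‖heatFlow v₀ (1 * t) x‖ ^ 2) *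
        ⟪v t x, gradient θ x⟫) := by
    refine integral_congr_ae (ae_of_all _ fun t => integral_congr_ae (ae_of_all _ fun x => ?_))
    have h1 := pw t x (fun E => (‖v t x - E x‖ ^ 2 - ‖E x‖ ^ 2) * ⟪v t x, gradient θ x⟫)
    simp only [hφg, inner_smul_right] at h1 ⊢
    rw [← h1]; ring
  have e3 : (∫ t, ∫ x, π t x * ⟪v t x - Ec t x, gradient (φ t) x⟫) =
      ∫ t, ∫ x, σ t * (π t x * ⟪v t x - heatFlow v₀ (1 * t) x, gradient θ x⟫) := by
    refine integral_congr_ae (ae_of_all _ fun t => integral_congr_ae (ae_of_all _ fun x => ?_))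
    have h1 := pw t x (fun E => π t x * ⟪v t x - E x, gradient θ x⟫)
    simp only [hφg, inner_smul_right] at h1 ⊢
    rw [← h1]; ring
  have e4 : (∫ t, ∫ x, φ t x * ⟪fderiv ℝ (Ec t) x (v t x - Ec t x), v t x - Ec t x⟫) =
      ∫ t, ∫ x, σ t * (θ x *
        ⟪fderiv ℝ (heatFlow v₀ (1 * t)) x (v t x - heatFlow v₀ (1 * t) x), v t x - heatFlow v₀ (1 * t) x⟫) := by
    refine integral_congr_ae (ae_of_all _ fun t => integral_congr_ae (ae_of_all _ fun x => ?_))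
    have h1 := pw t x (fun E => θ x * ⟪fderiv ℝ E x (v t x - E x), v t x - E x⟫)
    simp only [hφdef] at h1 ⊢
    rw [← h1]; ring
  have e5 : (∫ t, ∫ x, φ t x * ⟪fderiv ℝ (Ec t) x (Ec t x), v t x - Ec t x⟫) =
      ∫ t, ∫ x, σ t * (θ x *
        ⟪fderiv ℝ (heatFlow v₀ (1 * t)) x (heatFlow v₀ (1 * t) x), v t x - heatFlow v₀ (1 * t) x⟫) := by
    refine integral_congr_ae (ae_of_all _ fun t => integral_congr_ae (ae_of_all _ fun x => ?_))
    have h1 := pw t x (fun E => θ x * ⟪fderiv ℝ E x (E x), v t x - E x⟫)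
    simp only [hφdef] at h1 ⊢
    rw [← h1]; ring
  have e6 : (∫ t, ∫ x, ‖Ec t x‖ ^ 2 * ⟪v t x - Ec t x, gradient (φ t) x⟫) =
      ∫ t, ∫ x, σ t * (‖heatFlow v₀ (1 * t) x‖ ^ 2 * ⟪v t x - heatFlow v₀ (1 * t) x, gradient θ x⟫) := by
    refine integral_congr_ae (ae_of_all _ fun t => integral_congr_ae (ae_of_all _ fun x => ?_))
    have h1 := pw t x (fun E => ‖E x‖ ^ 2 * ⟪v t x - E x, gradient θ x⟫)
    simp only [hφg, inner_smul_right] at h1 ⊢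
    rw [← h1]; ring
  have e7 : (∫ t, ∫ x, ⟪Ec t x, gradient (φ t) x⟫ * ‖Ec t x‖ ^ 2) =
      ∫ t, ∫ x, σ t * (⟪heatFlow v₀ (1 * t) x, gradient θ x⟫ * ‖heatFlow v₀ (1 * t) x‖ ^ 2) := by
    refine integral_congr_ae (ae_of_all _ fun t => integral_congr_ae (ae_of_all _ fun x => ?_))
    have h1 := pw t x (fun E => ⟪E x, gradient θ x⟫ * ‖E x‖ ^ 2)
    simp only [hφg, inner_smul_right] at h1 ⊢
    rw [← h1]; ring
  rw [eL, e1, e2, e3, e4, e5, e6, e7] at h5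
  simpa only [mul_one] using h5

end IsLocalLeraySolutionOn

end Literature.Analysis.FluidPDE

end
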